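import Mathlib.Analysis.Fourier.AddCircle
import Mathlib.Analysis.SpecialFunctions.Complex.Log
import Mathlib.Analysis.SpecialFunctions.Integrals.Basic
import Mathlib.MeasureTheory.Integral.IntervalIntegral.Basic
import Mathlib.LinearAlgebra.Matrix.Determinant.Basic
import Mathlib.Topology.Algebra.InfiniteSum.Basic
import HarnessLib

/-!
# Toeplitz determinants and the strong Szegő limit theorem

Topic `Analysis/Toeplitz`, namespace `Literature.Analysis.Toeplitz`. The objects of the classical
theory of large Toeplitz determinants, as set up in

* P. Deift, A. Its, I. Krasovsky, *Toeplitz matrices and Toeplitz determinants under the impetus of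
  the Ising model. Some history and some recent results*, Comm. Pure Appl. Math. **66** (2013)
  1360–1438 ("DIK"), §1 (eqs. (1)–(3): Fourier coefficients `φ_ℓ = ∫_{-π}^{π} e^{-iℓθ} φ(e^{iθ}) dθ/2π`,
  `T_n(φ) = (φ_{j-k})_{0 ≤ j,k ≤ n-1}`, `D_n(φ) = det T_n(φ)`) and §3 (Theorem 3, Szegő 1952; Theorem 7,
  the strong Szegő limit theorem for complex symbols, Widom 1976 / Johansson 1988),

and the **strong Szegő limit theorem** (SSLT) as a named fact (`strongSzego`), in the complex-symbol
form of DIK Theorem 7, for continuous `2π`-periodic `V` (a special case of the printed hypothesis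
`V ∈ L¹(S¹)`; the second printed hypothesis `∑ |k| |V_k|² < ∞` is kept verbatim). This is the
analytic input of the Onsager–Kaufman–Yang spontaneous magnetisation of the planar Ising model
(Montroll–Potts–Ward 1963; see `Literature.Probability.LatticeModels.OnsagerYang` and DIK §4): the
row two-point function is a Toeplitz determinant `D_n(φ_Onsager)` and SSLT evaluates its limit.

## Contents

* `circleCoeff f ℓ = (2π)⁻¹ ∫_{-π}^{π} e^{-iℓθ} f(θ) dθ` for `f : ℝ → ℂ` (read as a function of the angle,
  `2π`-periodic in the applications) — DIK eq. (1), written out as the printed interval integral so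
  that Riemann-sum and series computations can address it directly; it IS Mathlib's
  `fourierCoeffOn (-π < π) f ℓ` (`circleCoeff_eq_fourierCoeffOn`, proved), through which the whole
  `AddCircle` Fourier theory (`fourierCoeffOn.const_mul`, Parseval, …) applies to it;
* `toeplitzMatrix c n = (c (j - k))_{j,k < n}` and `toeplitzDet c n = det (toeplitzMatrix c n)` for a
  coefficient sequence `c : ℤ → ℂ` — DIK eqs. (2)–(3); `toeplitzDet_zero`, `toeplitzDet_one`,
  `toeplitzMatrix_apply`;
* `strongSzego` — DIK Theorem 7 (named fact, cited).

## Mathlib status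

Mathlib has Fourier coefficients on `AddCircle T` (`fourierCoeff`, `fourierCoeffOn`,
`fourierCoeffOn_eq_integral`, `fourier_coe_apply` — used for the bridge), determinants
(`Matrix.det`), but no Toeplitz matrices/determinants as such and no Szegő limit theorem (searched:
`Toeplitz`, `Szego`, `Szegő`; the tree's `Literature.Analysis.TotalPositivity.toeplitzMinor` concerns
minors of one-sided sequences). Anchors: `intervalIntegral`, `Matrix.det`, `Matrix.of`,
`Matrix.det_isEmpty`, `Matrix.det_unique`, `tsum`.

## References

* G. Szegő, *On certain Hermitian forms associated with the Fourier series of a positive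
  function*, Comm. Sém. Math. Univ. Lund, tome suppl. (1952) 228–238.
* H. Widom, *Asymptotic behavior of block Toeplitz matrices and determinants. II*, Adv. Math. 21
  (1976) 1–29.
* K. Johansson, *On Szegő's asymptotic formula for Toeplitz determinants and generalizations*,
  Bull. Sci. Math. 112 (1988) 257–304.
* P. Deift, A. Its, I. Krasovsky, Comm. Pure Appl. Math. 66 (2013) 1360–1438, §§1, 3.
-/

noncomputable section

open Filter Topology Complex MeasureTheory intervalIntegral

namespace Literature.Analysis.Toeplitz

/-! ### Fourier coefficients on the circle -/

/-- The `ℓ`-th **Fourier coefficient** of a function of the angle `θ`,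
`f_ℓ = (2π)⁻¹ ∫_{-π}^{π} e^{-iℓθ} f(θ) dθ` (Deift–Its–Krasovsky 2013, eq. (1):
"`φ_ℓ = ∫_{-π}^{π} e^{-iℓθ} φ(e^{iθ}) dθ/2π`, `ℓ ∈ ℤ`"). Intended for `2π`-periodic `f : ℝ → ℂ`; no
periodicity or integrability is assumed in the definition (Lean's interval integral of a
non-integrable function is `0`). Equal to Mathlib's `fourierCoeffOn (-π < π) f ℓ`
(`circleCoeff_eq_fourierCoeffOn`). [cite: DeiftItsKrasovsky2013, §1, eq. (1)] -/
def circleCoeff (f : ℝ → ℂ) (ℓ : ℤ) : ℂ :=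
  (2 * Real.pi : ℂ)⁻¹ * ∫ θ in (-Real.pi)..Real.pi, Complex.exp (-(ℓ * θ * Complex.I)) * f θ

/-- Unfolding of `circleCoeff`. [cite: DeiftItsKrasovsky2013, §1, eq. (1)] -/
theorem circleCoeff_def (f : ℝ → ℂ) (ℓ : ℤ) :
    circleCoeff f ℓ =
      (2 * Real.pi : ℂ)⁻¹ * ∫ θ in (-Real.pi)..Real.pi, Complex.exp (-(ℓ * θ * Complex.I)) * f θ :=
  rfl

/-- **Bridge to Mathlib**: `circleCoeff f ℓ` is the Fourier coefficient `fourierCoeffOn (-π < π) f ℓ`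
of the lift of `f` to `AddCircle (2π)` (Mathlib's `fourierCoeffOn_eq_integral` and
`fourier_coe_apply`: `fourier (-ℓ) x = e^{2πi(-ℓ)x/(π-(-π))} = e^{-iℓx}`, `1/(π-(-π)) = (2π)⁻¹`). [folklore] -/
theorem circleCoeff_eq_fourierCoeffOn (f : ℝ → ℂ) (ℓ : ℤ) :
    circleCoeff f ℓ = fourierCoeffOn (neg_lt_self Real.pi_pos) f ℓ := by
  rw [fourierCoeffOn_eq_integral, circleCoeff, Complex.real_smul]
  have hT : ((Real.pi - -Real.pi : ℝ) : ℂ) ≠ 0 := by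
    norm_num
  congr 1
  · push_cast
    field_simp
    ring
  · refine intervalIntegral.integral_congr fun x _ => ?_
    simp only [fourier_coe_apply, smul_eq_mul]
    congr 1
    congr 1
    push_cast
    field_simp
    ring

/-! ### Toeplitz matrices and determinants -/

/-- The `n × n` **Toeplitz matrix** of a two-sided sequence `c : ℤ → ℂ`,
`T_n = (c_{j-k})_{0 ≤ j,k ≤ n-1}` (Deift–Its–Krasovsky 2013, §1, eq. (2)). [cite: DeiftItsKrasovsky2013, §1, eq. (2)] -/
def toeplitzMatrix (c : ℤ → ℂ) (n : ℕ) : Matrix (Fin n) (Fin n) ℂ :=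
  Matrix.of fun j k : Fin n => c ((j : ℤ) - (k : ℤ))

/-- Entries of the Toeplitz matrix: `(T_n)_{jk} = c_{j-k}`. [cite: DeiftItsKrasovsky2013, §1, eq. (2)] -/
@[simp] theorem toeplitzMatrix_apply (c : ℤ → ℂ) (n : ℕ) (j k : Fin n) :
    toeplitzMatrix c n j k = c ((j : ℤ) - (k : ℤ)) := rfl

/-- The `n × n` **Toeplitz determinant** `D_n = det T_n = det (c_{j-k})_{0 ≤ j,k ≤ n-1}` of a
two-sided sequence (Deift–Its–Krasovsky 2013, §1, eq. (3)); for the Fourier coefficients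
`c = circleCoeff φ` of a symbol `φ` this is `D_n(φ)`. [cite: DeiftItsKrasovsky2013, §1, eq. (3)] -/
def toeplitzDet (c : ℤ → ℂ) (n : ℕ) : ℂ :=
  (toeplitzMatrix c n).det

/-- `D_0 = 1` (empty determinant). [folklore] -/
@[simp] theorem toeplitzDet_zero (c : ℤ → ℂ) : toeplitzDet c 0 = 1 := by
  simp [toeplitzDet]

/-- `D_1 = c_0`. [folklore] -/
@[simp] theorem toeplitzDet_one (c : ℤ → ℂ) : toeplitzDet c 1 = c 0 := by
  simp [toeplitzDet, Matrix.det_unique]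

/-! ### The strong Szegő limit theorem -/

/-- **The strong Szegő limit theorem for complex symbols** (Deift–Its–Krasovsky, CPAM 66 (2013),
§3, Theorem 7: "Let `V(e^{iθ}) ∈ L¹(S¹)` be a (possibly complex-valued) function on `S¹` with Fourier
coefficients `(V_k)_{k∈ℤ}` satisfying `∑_{k=-∞}^{∞} |k| |V_k|² < ∞`, then
`lim_{n→∞} D_n(e^V) / e^{nV_0} = e^{∑_{k=1}^∞ k V_k V_{-k}}`" — proved by Johansson, Bull. Sci. Math.
112 (1988) 257, and under the additional assumption `V ∈ L^∞` by Widom, Adv. Math. 21 (1976) 1;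
for positive `C^{1+ε}` symbols it is Szegő's 1952 theorem, ibid. Theorem 3, with
`E(φ) = ∑ k |(log φ)_k|²`). Vendored for the SPECIAL CASE of a continuous `2π`-periodic `V : ℝ → ℂ`
(a subclass of `L¹(S¹)`; then `e^V` is a continuous nonvanishing symbol of winding number zero),
with the printed hypothesis `∑ |k| |V_k|² < ∞` verbatim: then, with
`D_n(e^V) = toeplitzDet (circleCoeff (exp ∘ V)) n` and `V_k = circleCoeff V k`,
`D_n(e^V) / exp(n V_0) → exp(∑_{k ≥ 1} k V_k V_{-k})` as `n → ∞`. [cite: DeiftItsKrasovsky2013, §3, Theorem 7 (Johansson 1988; Widom 1976)] -/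
def strongSzego : Prop :=
  ∀ (V : ℝ → ℂ), Continuous V → Function.Periodic V (2 * Real.pi) →
    Summable (fun k : ℤ => (|k| : ℝ) * ‖circleCoeff V k‖ ^ 2) →
      Tendsto (fun n : ℕ => toeplitzDet (circleCoeff fun θ => Complex.exp (V θ)) n /
          Complex.exp (n * circleCoeff V 0)) atTop
        (𝓝 (Complex.exp (∑' k : ℕ, ((k : ℂ) + 1) * circleCoeff V ((k : ℤ) + 1) *
          circleCoeff V (-((k : ℤ) + 1)))))

end Literature.Analysis.Toeplitz
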